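import Literature.Topology.FourManifolds.IwaseToriTools
import Literature.Topology.FourManifolds.IwasePolarModel
import Literature.Topology.FourManifolds.RadialSaturation
import Mathlib.Analysis.Calculus.InverseFunctionTheorem.ContDiff
import Mathlib.Analysis.Calculus.DSlope
import Mathlib.Analysis.SpecialFunctions.ExpDeriv
import Mathlib.Analysis.InnerProductSpace.Calculus
import HarnessLib

/-!
# The fibre family of the graph zone of the Iwase tori

Auxiliary construction for the tubular neighbourhood maps `T₀, T₁ : T² × ℝ² → S² × ℝ²` of the
model datum of Iwase's Proposition 3.5 [cite: Iwase1988, Prop. 3.5, p. 296] (reduction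
`TorusSurgeryIwaseReduction`).  Over the *graph zone* (the part `w = g(x)` of the torus over the
sphere, away from the handle) the fibres of the tubular neighbourhood interpolate between
*vertical* fibres (the `w`-plane, forced at the equator) and *slice* fibres (`‖w‖ = const`, the
structure of the handle); this file constructs that interpolating family in meridian
coordinates `(ξ, W)` (height on the sphere, plane coordinate) and inverts it.

* `muF`, `Cmu`, `qMax`, `nuMax`: the blend cut-off `μ(x₀)`, an *abstract* bound `C_μ` on `|μ'|`
  (never computed), and the fibre scales defined from it (`q_max C_μ ≤ 1/8`).
* `SF`, `XiF`: the blend factor `S = 1 - μ(1 - η²) q` and the ambient height `Ξ(η, q) = η √S`;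
  `hasDerivAt_XiF`, `deriv_XiF_ge` (`∂Ξ/∂η ≥ 1/4`), `strictMono_XiF`, `surjective_XiF`; the
  inverse `etaOf` and its **joint smoothness** `contDiffAt_etaOf` by the inverse function
  theorem applied to the triangular map `Bmap (η, q) = (Ξ, q)` (`exists_hasFDerivAt_Bmap`).
* `Efun ν = (e^ν - 1)/ν` (`dslope exp 0`; analytic, non-vanishing for `‖ν‖ < 1`), `epsF` (the
  fibre scale `ε(X)`, `= 1 - X` on the affine zone), `qOf ν = 1 - e^{-Re ν}`.
* **The fibre map** `fibV (η, ν) = (ξ, W)` with `ξ = Ξ(η, q(ν))`, `X = 1 - ξ²`,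
  `W = g(X) + ε(X)(e^ν - 1)`; the exactness witness `WV_sub_gprof : W - g(X) = ν · ε(X) E(ν)`
  (which makes the polar phase smooth in the sheared fibre coordinate); the explicit inverse
  `fibVInv` (`ν = log (1 + (W - g(X))/ε(X))`, `η = etaOf ξ q`), both inverse identities,
  smoothness both ways, `fibVPH : OpenPartialHomeomorph`, `isLocalDiffeomorphAt_fibV`.
* **The fibre coordinate of the plane** `nuOfV v = ν_max · toC (univUnitBall v)` (Mathlib's
  radial squeeze), `vOfNu`, `nuOfVPH`, `isLocalDiffeomorphAt_nuOfV`, `nrm_nuOfV`.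

All statements are elementary [folklore].

## References
* Z. Iwase, *Dehn-surgery along a torus T²-knot*, Pacific J. Math. 133 (1988), 289–299,
  Prop. 3.5. [cite: Iwase1988]
-/

open scoped ContDiff Topology Manifold
open Set Function Real Filter

noncomputable section

namespace Literature.Topology.FourManifolds

namespace IwaseTori

/-! ### The blend cut-off `μ`, its derivative bound, and the fibre scale -/

/-- **The fibre-type cut-off** `μ(x₀) = 1 - cut (1/25) (2/25) x₀`: `1` (slice fibres) for
`x₀ ≤ 1/25`, `0` (vertical fibres) for `x₀ ≥ 2/25`. [folklore] -/
def muF (x : ℝ) : ℝ := 1 - cut (1 / 25) (2 / 25) x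

/-- `μ = 1` for `x₀ ≤ 1/25`. [folklore] -/
theorem muF_of_le {x : ℝ} (hx : x ≤ 1 / 25) : muF x = 1 := by
  rw [muF, cut_of_le (by norm_num) hx]; ring

/-- `μ = 0` for `x₀ ≥ 2/25`. [folklore] -/
theorem muF_of_ge {x : ℝ} (hx : 2 / 25 ≤ x) : muF x = 0 := by
  rw [muF, cut_of_ge (by norm_num) hx]; ring

/-- `0 ≤ μ ≤ 1`. [folklore] -/
theorem muF_mem (x : ℝ) : 0 ≤ muF x ∧ muF x ≤ 1 := by
  have h0 := cut_nonneg (1 / 25) (2 / 25) x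
  have h1 := cut_le_one (1 / 25) (2 / 25) x
  unfold muF; constructor <;> linarith

/-- `μ` is smooth. [folklore] -/
theorem contDiff_muF : ContDiff ℝ ∞ muF := contDiff_const.sub (contDiff_cut _ _)

/-- `μ` is differentiable. [folklore] -/
theorem differentiable_muF : Differentiable ℝ muF := contDiff_muF.differentiable (by simp)

/-- **An abstract bound on `μ'` exists.** [folklore] -/
theorem exists_bound_deriv_muF : ∃ C : ℝ, 0 < C ∧ ∀ x, |deriv muF x| ≤ C := by
  obtain ⟨C, hC, h⟩ := exists_bound_deriv_cut (a := 1 / 25) (b := 2 / 25) (by norm_num)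
  refine ⟨C, hC, fun x => ?_⟩
  have : deriv muF x = -deriv (cut (1 / 25) (2 / 25)) x := by
    have e : muF = fun x => (1 : ℝ) - cut (1 / 25) (2 / 25) x := rfl
    rw [e, deriv_const_sub]
  rw [this, abs_neg]
  exact h x

/-- **The derivative bound `C_μ`** (an abstract constant; never computed). [folklore] -/
def Cmu : ℝ := Classical.choose exists_bound_deriv_muF

/-- `C_μ > 0`. [folklore] -/
theorem Cmu_pos : 0 < Cmu := (Classical.choose_spec exists_bound_deriv_muF).1

/-- `|μ'| ≤ C_μ`. [folklore] -/
theorem abs_deriv_muF_le (x : ℝ) : |deriv muF x| ≤ Cmu :=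
  (Classical.choose_spec exists_bound_deriv_muF).2 x

/-- `μ' = 0` off `(1/25, 2/25)`: stated for `x < 1/25`. [folklore] -/
theorem deriv_muF_of_lt {x : ℝ} (hx : x < 1 / 25) : deriv muF x = 0 := by
  have hev : muF =ᶠ[𝓝 x] fun _ => (1 : ℝ) := by
    filter_upwards [(isOpen_lt continuous_id continuous_const).mem_nhds hx] with y hy
    exact muF_of_le (le_of_lt hy)
  rw [hev.deriv_eq, deriv_const]

/-- `μ' = 0` for `x > 2/25`. [folklore] -/
theorem deriv_muF_of_gt {x : ℝ} (hx : 2 / 25 < x) : deriv muF x = 0 := by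
  have hev : muF =ᶠ[𝓝 x] fun _ => (0 : ℝ) := by
    filter_upwards [(isOpen_lt continuous_const continuous_id).mem_nhds hx] with y hy
    exact muF_of_ge (le_of_lt hy)
  rw [hev.deriv_eq, deriv_const]

/-- **The maximal fibre parameter** `q_max = min (1/500) (1/(8 (1 + C_μ)))`: small enough for
all the explicit estimates and for `q_max · C_μ ≤ 1/8`. [folklore] -/
def qMax : ℝ := min (1 / 500) (1 / (8 * (1 + Cmu)))

/-- `q_max > 0`. [folklore] -/
theorem qMax_pos : 0 < qMax := lt_min (by norm_num) (by have := Cmu_pos; positivity)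

/-- `q_max ≤ 1/500`. [folklore] -/
theorem qMax_le : qMax ≤ 1 / 500 := min_le_left _ _

/-- `q_max · C_μ ≤ 1/8`. [folklore] -/
theorem qMax_mul_Cmu_le : qMax * Cmu ≤ 1 / 8 := by
  have hC := Cmu_pos
  have h : qMax ≤ 1 / (8 * (1 + Cmu)) := min_le_right _ _
  calc qMax * Cmu ≤ 1 / (8 * (1 + Cmu)) * Cmu := by gcongr
    _ ≤ 1 / 8 := by rw [div_mul_eq_mul_div, div_le_iff₀ (by positivity)]; nlinarith

/-! ### The blend factor `S(η, q) = 1 - μ(1 - η²) q` and the ambient height `Ξ(η, q) = η √S` -/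

/-- **The blend factor** `S(η, q) = 1 - μ(1 - η²) q` (`η` = core height, so `x₀ = 1 - η²`;
`q = 1 - e^{-a}` the radial fibre parameter). [folklore] -/
def SF (η q : ℝ) : ℝ := 1 - muF (1 - η ^ 2) * q

/-- `1/2 ≤ S ≤ 3/2` for `|q| ≤ 1/2`. [folklore] -/
theorem SF_mem {η q : ℝ} (hq : |q| ≤ 1 / 2) : 1 / 2 ≤ SF η q ∧ SF η q ≤ 3 / 2 := by
  obtain ⟨h0, h1⟩ := muF_mem (1 - η ^ 2)
  obtain ⟨hq1, hq2⟩ := abs_le.1 hq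
  unfold SF; constructor <;> nlinarith

/-- `S > 0` for `|q| ≤ 1/2`. [folklore] -/
theorem SF_pos {η q : ℝ} (hq : |q| ≤ 1 / 2) : 0 < SF η q := by linarith [(SF_mem (η := η) hq).1]

/-- `S(η, 0) = 1`. [folklore] -/
@[simp] theorem SF_zero (η : ℝ) : SF η 0 = 1 := by simp [SF]

/-- `S = 1 - q` where `μ = 1` (`η² ≥ 24/25`). [folklore] -/
theorem SF_of_sq_ge {η : ℝ} (hη : 24 / 25 ≤ η ^ 2) (q : ℝ) : SF η q = 1 - q := by
  rw [SF, muF_of_le (by linarith), one_mul]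

/-- `S = 1` where `μ = 0` (`η² ≤ 23/25`). [folklore] -/
theorem SF_of_sq_le {η : ℝ} (hη : η ^ 2 ≤ 23 / 25) (q : ℝ) : SF η q = 1 := by
  rw [SF, muF_of_ge (by linarith), zero_mul, sub_zero]

/-- `S` is jointly smooth. [folklore] -/
theorem contDiff_SF : ContDiff ℝ ∞ fun p : ℝ × ℝ => SF p.1 p.2 := by
  unfold SF
  exact contDiff_const.sub ((contDiff_muF.comp (contDiff_const.sub (contDiff_fst.pow 2))).mul
    contDiff_snd)

/-- **The ambient height** `Ξ(η, q) = η √S(η, q)` of the fibre point with radial parameter `q`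
over the core point of height `η`. [folklore] -/
def XiF (η q : ℝ) : ℝ := η * Real.sqrt (SF η q)

/-- `Ξ(η, 0) = η`. [folklore] -/
@[simp] theorem XiF_zero (η : ℝ) : XiF η 0 = η := by simp [XiF]

/-- `Ξ = η √(1 - q)` where `μ = 1`. [folklore] -/
theorem XiF_of_sq_ge {η : ℝ} (hη : 24 / 25 ≤ η ^ 2) (q : ℝ) : XiF η q = η * Real.sqrt (1 - q) := by
  rw [XiF, SF_of_sq_ge hη]

/-- `Ξ = η` where `μ = 0`. [folklore] -/
theorem XiF_of_sq_le {η : ℝ} (hη : η ^ 2 ≤ 23 / 25) (q : ℝ) : XiF η q = η := by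
  rw [XiF, SF_of_sq_le hη, Real.sqrt_one, mul_one]

/-- `1 - Ξ² = x₀ + μ(x₀)(1 - x₀) q` with `x₀ = 1 - η²` (for `S ≥ 0`). [folklore] -/
theorem one_sub_XiF_sq {η q : ℝ} (hq : |q| ≤ 1 / 2) :
    1 - XiF η q ^ 2 = (1 - η ^ 2) + muF (1 - η ^ 2) * (1 - (1 - η ^ 2)) * q := by
  rw [XiF, mul_pow, Real.sq_sqrt (SF_pos hq).le, SF]; ring

/-- `Ξ` is jointly smooth on `|q| < 1/2`. [folklore] -/
theorem contDiffAt_XiF {p : ℝ × ℝ} (hp : |p.2| < 1 / 2) :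
    ContDiffAt ℝ ∞ (fun p : ℝ × ℝ => XiF p.1 p.2) p := by
  unfold XiF
  exact contDiffAt_fst.mul (contDiff_SF.contDiffAt.sqrt (SF_pos hp.le).ne')

/-- **The `η`-derivative of `Ξ`**: `√S + η · (2 η q μ'(1 - η²)) / (2 √S)`. [folklore] -/
theorem hasDerivAt_XiF {η q : ℝ} (hq : |q| ≤ 1 / 2) :
    HasDerivAt (fun η => XiF η q)
      (Real.sqrt (SF η q) + η * ((2 * η * q * deriv muF (1 - η ^ 2)) / (2 * Real.sqrt (SF η q)))) η := by
  have hS := SF_pos (η := η) hq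
  -- derivative of `S(·, q)`
  have hmu : HasDerivAt (fun η => muF (1 - η ^ 2)) (deriv muF (1 - η ^ 2) * (-(2 * η))) η := by
    have h1 : HasDerivAt (fun η : ℝ => 1 - η ^ 2) (-(2 * η)) η := by
      simpa using ((hasDerivAt_pow 2 η).const_sub 1)
    exact (differentiable_muF _).hasDerivAt.comp η h1
  have hSd : HasDerivAt (fun η => SF η q) (2 * η * q * deriv muF (1 - η ^ 2)) η := by
    show HasDerivAt (fun η => 1 - muF (1 - η ^ 2) * q) _ η
    exact ((hmu.mul_const q).const_sub 1).congr_deriv (by ring)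
  have hsq : HasDerivAt (fun η => Real.sqrt (SF η q))
      ((2 * η * q * deriv muF (1 - η ^ 2)) / (2 * Real.sqrt (SF η q))) η := hSd.sqrt hS.ne'
  show HasDerivAt (fun η => η * Real.sqrt (SF η q)) _ η
  exact ((hasDerivAt_id' η).mul hsq).congr_deriv (by ring)

/-- **The `η`-derivative of `Ξ` is at least `1/4`** for `|q| ≤ q_max` (the correction term is
small because `q_max C_μ ≤ 1/8` and `μ' = 0` unless `η² < 1`). [folklore] -/
theorem deriv_XiF_ge {η q : ℝ} (hq : |q| ≤ qMax) : 1 / 4 ≤ deriv (fun η => XiF η q) η := by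
  have hq2 : |q| ≤ 1 / 2 := hq.trans (qMax_le.trans (by norm_num))
  rw [(hasDerivAt_XiF hq2).deriv]
  obtain ⟨hS1, hS2⟩ := SF_mem (η := η) hq2
  have hsqrt : Real.sqrt (1 / 2) ≤ Real.sqrt (SF η q) := Real.sqrt_le_sqrt hS1
  have h07 : (0.7 : ℝ) ≤ Real.sqrt (1 / 2) := by
    rw [Real.le_sqrt (by norm_num) (by norm_num)]; norm_num
  have hspos : 0 < Real.sqrt (SF η q) := by linarith
  -- the correction term: `|2 η² q μ'| ≤ 2 q_max C_μ ≤ 1/4`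
  have hcorr : |η * (2 * η * q * deriv muF (1 - η ^ 2))| ≤ 1 / 4 := by
    by_cases hη : η ^ 2 ≤ 1
    · have h1 : |deriv muF (1 - η ^ 2)| ≤ Cmu := abs_deriv_muF_le _
      have h2 := qMax_mul_Cmu_le
      rw [show η * (2 * η * q * deriv muF (1 - η ^ 2)) = 2 * η ^ 2 * (q * deriv muF (1 - η ^ 2)) by ring,
        abs_mul, abs_mul, abs_of_pos (by norm_num : (0 : ℝ) < 2), abs_of_nonneg (sq_nonneg η), abs_mul]
      have h3 : |q| * |deriv muF (1 - η ^ 2)| ≤ qMax * Cmu :=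
        mul_le_mul hq h1 (abs_nonneg _) qMax_pos.le
      nlinarith [abs_nonneg q, abs_nonneg (deriv muF (1 - η ^ 2)), sq_nonneg η]
    · push Not at hη
      rw [deriv_muF_of_lt (by linarith), mul_zero, mul_zero, abs_zero]; norm_num
  have h2pos : (0 : ℝ) < 2 * Real.sqrt (SF η q) := by linarith
  have hT : |η * ((2 * η * q * deriv muF (1 - η ^ 2)) / (2 * Real.sqrt (SF η q)))| ≤ 1 / 4 := by
    rw [← mul_div_assoc, abs_div, abs_of_pos h2pos, div_le_iff₀ h2pos]
    nlinarith
  have := neg_abs_le (η * ((2 * η * q * deriv muF (1 - η ^ 2)) / (2 * Real.sqrt (SF η q))))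
  linarith

/-- `Ξ(·, q)` is smooth for `|q| < 1/2`. [folklore] -/
theorem contDiff_XiF_left {q : ℝ} (hq : |q| < 1 / 2) : ContDiff ℝ ∞ fun η => XiF η q :=
  contDiff_iff_contDiffAt.2 fun η => (contDiffAt_XiF (p := (η, q)) hq).comp η
    (contDiffAt_id.prodMk contDiffAt_const)

/-- **`Ξ(·, q)` is strictly increasing** for `|q| ≤ q_max`. [folklore] -/
theorem strictMono_XiF {q : ℝ} (hq : |q| ≤ qMax) : StrictMono fun η => XiF η q :=
  strictMono_of_deriv_pos fun η => lt_of_lt_of_le (by norm_num) (deriv_XiF_ge (η := η) hq)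

/-- **`Ξ(·, q)` is surjective** (it is linear of positive slope `√(1 - q)` for `η² ≥ 24/25`).
[folklore] -/
theorem surjective_XiF {q : ℝ} (hq : |q| ≤ qMax) : Surjective fun η => XiF η q := by
  have hq2 : |q| < 1 / 2 := lt_of_le_of_lt hq (qMax_le.trans_lt (by norm_num))
  have hc : 0 < Real.sqrt (1 - q) := Real.sqrt_pos.2 (by linarith [(abs_le.1 hq2.le).2])
  have hcont : Continuous fun η => XiF η q := (contDiff_XiF_left hq2).continuous
  have hev1 : (fun η => XiF η q) =ᶠ[atTop] fun η => η * Real.sqrt (1 - q) := by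
    filter_upwards [eventually_ge_atTop (1 : ℝ)] with η hη
    exact XiF_of_sq_ge (by nlinarith) q
  have hev2 : (fun η => XiF η q) =ᶠ[atBot] fun η => η * Real.sqrt (1 - q) := by
    filter_upwards [eventually_le_atBot (-1 : ℝ)] with η hη
    exact XiF_of_sq_ge (by nlinarith) q
  refine hcont.surjective ?_ ?_
  · exact (Filter.tendsto_id.atTop_mul_const hc).congr' hev1.symm
  · exact (Filter.tendsto_id.atBot_mul_const hc).congr' hev2.symm

/-- **The core height as a function of the ambient height**: the inverse of `Ξ(·, q)` (junk
value for `|q| > q_max`). [folklore] -/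
def etaOf (ξ q : ℝ) : ℝ :=
  if h : |q| ≤ qMax then (monoHomeomorph _ (strictMono_XiF h) (surjective_XiF h)).symm ξ else 0

/-- `η(Ξ(η, q), q) = η`. [folklore] -/
theorem etaOf_XiF {η q : ℝ} (hq : |q| ≤ qMax) : etaOf (XiF η q) q = η := by
  rw [etaOf, dif_pos hq]
  exact monoHomeomorph_symm_apply_apply _ (strictMono_XiF hq) (surjective_XiF hq) η

/-- `Ξ(η(ξ, q), q) = ξ`. [folklore] -/
theorem XiF_etaOf {ξ q : ℝ} (hq : |q| ≤ qMax) : XiF (etaOf ξ q) q = ξ := by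
  rw [etaOf, dif_pos hq]
  exact apply_monoHomeomorph_symm _ (strictMono_XiF hq) (surjective_XiF hq) ξ

/-- `η(ξ, 0) = ξ`. [folklore] -/
@[simp] theorem etaOf_zero (ξ : ℝ) : etaOf ξ 0 = ξ := by
  have h := etaOf_XiF (η := ξ) (q := 0) (by rw [abs_zero]; exact qMax_pos.le)
  rwa [XiF_zero] at h

/-- Where `μ = 0` on the answer, `η = ξ`: if `ξ² ≤ 23/25` then `η(ξ, q) = ξ`. [folklore] -/
theorem etaOf_of_sq_le {ξ q : ℝ} (hξ : ξ ^ 2 ≤ 23 / 25) (hq : |q| ≤ qMax) : etaOf ξ q = ξ := by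
  have h := etaOf_XiF (η := ξ) hq
  rwa [XiF_of_sq_le hξ] at h

/-! ### Joint smoothness of `η(ξ, q)` by the inverse function theorem -/

/-- The triangular map `B(η, q) = (Ξ(η, q), q)`. [folklore] -/
def Bmap (p : ℝ × ℝ) : ℝ × ℝ := (XiF p.1 p.2, p.2)

/-- `B` is smooth on `|q| < 1/2`. [folklore] -/
theorem contDiffAt_Bmap {p : ℝ × ℝ} (hp : |p.2| < 1 / 2) : ContDiffAt ℝ ∞ Bmap p :=
  (contDiffAt_XiF hp).prodMk contDiffAt_snd

/-- `B` is injective on `|q| ≤ q_max`. [folklore] -/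
theorem Bmap_injOn : InjOn Bmap {p : ℝ × ℝ | |p.2| ≤ qMax} := by
  rintro ⟨η, q⟩ hq ⟨η', q'⟩ _ h
  simp only [Bmap, Prod.mk.injEq] at h
  obtain ⟨h1, rfl⟩ := h
  exact Prod.ext ((strictMono_XiF hq).injective h1) rfl

/-- **The derivative of `B` at a point with `|q| ≤ q_max` is invertible**: it is triangular
with diagonal entries `∂Ξ/∂η ≥ 1/4` and `1`. We produce it as a continuous linear equivalence
(abstractly, from the Fréchet derivative of `Ξ`). [folklore] -/
theorem exists_hasFDerivAt_Bmap {p : ℝ × ℝ} (hp : |p.2| ≤ qMax) :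
    ∃ L : (ℝ × ℝ) ≃L[ℝ] (ℝ × ℝ), HasFDerivAt Bmap (L : (ℝ × ℝ) →L[ℝ] (ℝ × ℝ)) p := by
  have hp2 : |p.2| < 1 / 2 := lt_of_le_of_lt hp (qMax_le.trans_lt (by norm_num))
  -- the abstract derivative of `Ξ`
  set D : (ℝ × ℝ) →L[ℝ] ℝ := fderiv ℝ (fun p : ℝ × ℝ => XiF p.1 p.2) p with hD
  have hXi : HasFDerivAt (fun p : ℝ × ℝ => XiF p.1 p.2) D p :=
    ((contDiffAt_XiF hp2).differentiableAt (by simp)).hasFDerivAt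
  have hB : HasFDerivAt Bmap (D.prod (ContinuousLinearMap.snd ℝ ℝ ℝ)) p := hXi.prodMk hasFDerivAt_snd
  -- `D (1, 0)` is the `η`-derivative of the slice, hence `≥ 1/4`
  have hslice : HasDerivAt (fun η => XiF η p.2) (D (1, 0)) p.1 := by
    have hincl : HasDerivAt (fun η : ℝ => (η, p.2)) ((1 : ℝ), (0 : ℝ)) p.1 :=
      (hasDerivAt_id p.1).prodMk (hasDerivAt_const p.1 p.2)
    have := hXi.comp_hasDerivAt p.1 hincl
    exact this
  have hD10 : 1 / 4 ≤ D (1, 0) := by rw [← hslice.deriv]; exact deriv_XiF_ge hp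
  have hD0 : D (1, 0) ≠ 0 := by intro h; rw [h] at hD10; norm_num at hD10
  -- the candidate inverse
  set M : (ℝ × ℝ) →L[ℝ] (ℝ × ℝ) := D.prod (ContinuousLinearMap.snd ℝ ℝ ℝ) with hM
  have hMapply : ∀ v : ℝ × ℝ, M v = (v.1 * D (1, 0) + v.2 * D (0, 1), v.2) := by
    intro v
    have hv : v = v.1 • ((1 : ℝ), (0 : ℝ)) + v.2 • ((0 : ℝ), (1 : ℝ)) := by ext <;> simp
    simp only [hM, ContinuousLinearMap.prod_apply, ContinuousLinearMap.coe_snd']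
    refine Prod.ext ?_ rfl
    conv_lhs => rw [hv]
    rw [map_add, map_smul, map_smul, smul_eq_mul, smul_eq_mul]
  let Ninv : (ℝ × ℝ) →L[ℝ] (ℝ × ℝ) :=
    ((D (1, 0))⁻¹ • (ContinuousLinearMap.fst ℝ ℝ ℝ - D (0, 1) • ContinuousLinearMap.snd ℝ ℝ ℝ)).prod
      (ContinuousLinearMap.snd ℝ ℝ ℝ)
  have hNapply : ∀ w : ℝ × ℝ, Ninv w = ((D (1, 0))⁻¹ * (w.1 - D (0, 1) * w.2), w.2) := by
    intro w; simp [Ninv]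
  have h1 : ∀ v, Ninv (M v) = v := by
    intro v
    rw [hMapply, hNapply]
    refine Prod.ext ?_ rfl
    show (D (1, 0))⁻¹ * ((v.1 * D (1, 0) + v.2 * D (0, 1)) - D (0, 1) * v.2) = v.1
    rw [show v.1 * D (1, 0) + v.2 * D (0, 1) - D (0, 1) * v.2 = D (1, 0) * v.1 by ring,
      ← mul_assoc, inv_mul_cancel₀ hD0, one_mul]
  have h2 : ∀ w, M (Ninv w) = w := by
    intro w
    rw [hNapply, hMapply]
    refine Prod.ext ?_ rfl
    show (D (1, 0))⁻¹ * (w.1 - D (0, 1) * w.2) * D (1, 0) + w.2 * D (0, 1) = w.1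
    rw [mul_comm ((D (1, 0))⁻¹) _, mul_assoc, inv_mul_cancel₀ hD0, mul_one]
    ring
  refine ⟨ContinuousLinearEquiv.equivOfInverse M Ninv h1 h2, ?_⟩
  exact hB

/-- **`η(ξ, q)` is jointly smooth** on `|q| < q_max`. [folklore] -/
theorem contDiffAt_etaOf {ξ q : ℝ} (hq : |q| < qMax) :
    ContDiffAt ℝ ∞ (fun w : ℝ × ℝ => etaOf w.1 w.2) (ξ, q) := by
  set η := etaOf ξ q with hη
  have hp : |((η, q) : ℝ × ℝ).2| ≤ qMax := hq.le
  obtain ⟨L, hL⟩ := exists_hasFDerivAt_Bmap hp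
  have hB : ContDiffAt ℝ ∞ Bmap (η, q) :=
    contDiffAt_Bmap (lt_of_le_of_lt hp (qMax_le.trans_lt (by norm_num)))
  have himage : Bmap (η, q) = (ξ, q) := by simp only [Bmap, hη, XiF_etaOf hq.le]
  -- the local inverse of the inverse function theorem
  set e := hB.toOpenPartialHomeomorph Bmap hL (by simp) with he
  have hsymm : ContDiffAt ℝ ∞ e.symm (ξ, q) := by
    have := hB.to_localInverse hL (by simp)
    rw [himage] at this
    exact this
  -- our global inverse agrees with `e.symm` near `(ξ, q)`
  have htarget : e.target ∈ 𝓝 (ξ, q) := by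
    rw [← himage]
    exact e.open_target.mem_nhds (hB.image_mem_toOpenPartialHomeomorph_target hL (by simp))
  have hqopen : ∀ᶠ w : ℝ × ℝ in 𝓝 (ξ, q), |w.2| < qMax :=
    (continuous_abs.comp continuous_snd).continuousAt.eventually_lt continuousAt_const hq
  have hsource : ∀ᶠ w : ℝ × ℝ in 𝓝 (ξ, q), |(e.symm w).2| < qMax := by
    have hc : ContinuousAt e.symm (ξ, q) := hsymm.continuousAt
    have : e.symm (ξ, q) = (η, q) := by
      rw [← himage]; exact e.left_inv (hB.mem_toOpenPartialHomeomorph_source hL (by simp))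
    have h2 : ContinuousAt (fun w => |(e.symm w).2|) (ξ, q) :=
      continuous_abs.continuousAt.comp (continuousAt_snd.comp hc)
    have hval : (fun w => |(e.symm w).2|) (ξ, q) < qMax := by simp only [this]; exact hq
    exact h2.eventually_lt continuousAt_const hval
  have hev : (fun w : ℝ × ℝ => (etaOf w.1 w.2, w.2)) =ᶠ[𝓝 (ξ, q)] e.symm := by
    filter_upwards [htarget, hqopen, hsource] with w hw hwq hws
    have hright : Bmap (e.symm w) = w := e.right_inv hw
    have h2 : (e.symm w).2 = w.2 := by
      have := congrArg Prod.snd hright; simpa [Bmap] using this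
    have h1 : XiF (e.symm w).1 w.2 = w.1 := by
      have := congrArg Prod.fst hright; simp only [Bmap] at this; rwa [h2] at this
    ext
    · simp only
      rw [← h1, etaOf_XiF hwq.le]
    · exact h2.symm
  have hpair : ContDiffAt ℝ ∞ (fun w : ℝ × ℝ => (etaOf w.1 w.2, w.2)) (ξ, q) :=
    hsymm.congr_of_eventuallyEq hev
  exact contDiffAt_fst.comp (ξ, q) hpair

/-! ### The holomorphic factor `E(ν) = (e^ν - 1)/ν` -/

/-- **`E(ν) = (e^ν - 1)/ν`**, extended by `E(0) = 1` (`dslope exp 0`). [folklore] -/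
def Efun (ν : ℂ) : ℂ := dslope Complex.exp 0 ν

/-- `E(0) = 1`. [folklore] -/
@[simp] theorem Efun_zero : Efun 0 = 1 := by
  rw [Efun, dslope_same, Complex.deriv_exp, Complex.exp_zero]

/-- `ν E(ν) = e^ν - 1`. [folklore] -/
theorem mul_Efun (ν : ℂ) : ν * Efun ν = Complex.exp ν - 1 := by
  have h := sub_smul_dslope Complex.exp 0 ν
  rwa [sub_zero, smul_eq_mul, Complex.exp_zero] at h

/-- `E(ν) = (e^ν - 1)/ν` for `ν ≠ 0`. [folklore] -/
theorem Efun_of_ne {ν : ℂ} (hν : ν ≠ 0) : Efun ν = (Complex.exp ν - 1) / ν := by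
  rw [eq_div_iff hν, mul_comm, mul_Efun]

/-- `E` is analytic. [folklore] -/
theorem analyticAt_Efun (ν : ℂ) : AnalyticAt ℂ Efun ν := by
  rcases eq_or_ne ν 0 with rfl | hν
  · obtain ⟨p, hp⟩ := (analyticAt_cexp : AnalyticAt ℂ Complex.exp 0)
    exact ⟨_, hp.has_fpower_series_dslope_fslope⟩
  · have h : AnalyticAt ℂ (fun z => (Complex.exp z - 1) / z) ν :=
      (analyticAt_cexp.sub analyticAt_const).div analyticAt_id hν
    refine h.congr ?_
    filter_upwards [isOpen_ne.mem_nhds hν] with z hz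
    exact (Efun_of_ne hz).symm

/-- `E` is (real) smooth. [folklore] -/
theorem contDiff_Efun : ContDiff ℝ ∞ Efun :=
  contDiff_iff_contDiffAt.2 fun ν => ((analyticAt_Efun ν).contDiffAt (n := ∞)).restrict_scalars ℝ

/-- `E(ν) ≠ 0` for `‖ν‖ < 1` (the zeros of `e^ν - 1` are `2πiℤ`). [folklore] -/
theorem Efun_ne_zero {ν : ℂ} (hν : ‖ν‖ < 1) : Efun ν ≠ 0 := by
  rcases eq_or_ne ν 0 with rfl | h0
  · rw [Efun_zero]; exact one_ne_zero
  · rw [Efun_of_ne h0, div_ne_zero_iff]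
    refine ⟨fun h => ?_, h0⟩
    rw [sub_eq_zero, Complex.exp_eq_one_iff] at h
    obtain ⟨n, hn⟩ := h
    have hnorm : ‖ν‖ = |(n : ℝ)| * (2 * π) := by
      rw [hn, norm_mul, norm_mul, norm_mul, Complex.norm_intCast, Complex.norm_two,
        Complex.norm_real, Real.norm_of_nonneg pi_pos.le, Complex.norm_I, mul_one]
    have hπ : 3 < π := pi_gt_three
    have hn0 : n = 0 := by
      by_contra hcon
      have : (1 : ℝ) ≤ |(n : ℝ)| := by
        rw [← Int.cast_abs]; exact_mod_cast Int.one_le_abs hcon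
      nlinarith
    apply h0
    rw [hn, hn0]; simp

/-! ### The fibre scale `ε` and the radial parameter `q(ν)` -/

/-- **The fibre scale** `ε(X) = 1 - X + cut (1/10) (3/20) X · (X - 1/2)`: equal to `g(X) = 1 - X`
on the affine zone `X ≤ 1/10`, to `1/2` for `X ≥ 3/20`, always `≥ 9/20`. [folklore] -/
def epsF (X : ℝ) : ℝ := 1 - X + cut (1 / 10) (3 / 20) X * (X - 1 / 2)

/-- `ε = 1 - X` for `X ≤ 1/10`. [folklore] -/
theorem epsF_of_le {X : ℝ} (hX : X ≤ 1 / 10) : epsF X = 1 - X := by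
  rw [epsF, cut_of_le (by norm_num) hX]; ring

/-- `ε = 1/2` for `X ≥ 3/20`. [folklore] -/
theorem epsF_of_ge {X : ℝ} (hX : 3 / 20 ≤ X) : epsF X = 1 / 2 := by
  rw [epsF, cut_of_ge (by norm_num) hX]; ring

/-- `ε ≥ 9/20`. [folklore] -/
theorem epsF_ge (X : ℝ) : 9 / 20 ≤ epsF X := by
  rcases le_or_gt X (1 / 10) with h | h
  · rw [epsF_of_le h]; linarith
  rcases le_or_gt (3 / 20) X with h' | h'
  · rw [epsF_of_ge h']; norm_num
  · have h0 := cut_nonneg (1 / 10) (3 / 20) X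
    have h1 := cut_le_one (1 / 10) (3 / 20) X
    unfold epsF; nlinarith

/-- `ε > 0`. [folklore] -/
theorem epsF_pos (X : ℝ) : 0 < epsF X := lt_of_lt_of_le (by norm_num) (epsF_ge X)

/-- `ε` is smooth. [folklore] -/
theorem contDiff_epsF : ContDiff ℝ ∞ epsF := by
  unfold epsF
  exact (contDiff_const.sub contDiff_id).add ((contDiff_cut _ _).mul (contDiff_id.sub contDiff_const))

/-- **The radial fibre parameter** `q(ν) = 1 - e^{-Re ν}`. [folklore] -/
def qOf (ν : ℂ) : ℝ := 1 - Real.exp (-ν.re)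

/-- `q(0) = 0`. [folklore] -/
@[simp] theorem qOf_zero : qOf 0 = 0 := by simp [qOf]

/-- `q` only depends on `Re ν`. [folklore] -/
theorem qOf_eq_of_re_eq {ν ν' : ℂ} (h : ν.re = ν'.re) : qOf ν = qOf ν' := by rw [qOf, qOf, h]

/-- `q` is smooth. [folklore] -/
theorem contDiff_qOf : ContDiff ℝ ∞ qOf :=
  contDiff_const.sub (Real.contDiff_exp.comp (Complex.reCLM.contDiff.neg))

/-- `|q(ν)| ≤ 2 ‖ν‖` for `‖ν‖ ≤ 1/2`. [folklore] -/
theorem abs_qOf_le {ν : ℂ} (hν : ‖ν‖ ≤ 1 / 2) : |qOf ν| ≤ 2 * ‖ν‖ := by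
  have ha : |ν.re| ≤ ‖ν‖ := Complex.abs_re_le_norm ν
  obtain ⟨ha1, ha2⟩ := abs_le.1 ha
  rw [qOf, abs_le]
  constructor
  · -- `e^{-a} - 1 ≤ 2‖ν‖`: from `e^x ≤ 1 + x + x²` for `x ≤ 1`... use `Real.add_one_le_exp` on `a`
    have h1 : Real.exp (-ν.re) ≤ 1 + 2 * ‖ν‖ := by
      have hx : -ν.re ≤ 1 / 2 := by linarith
      have := Real.exp_bound_div_one_sub_of_interval' (x := -ν.re)
      -- simpler: `exp x ≤ 1/(1 - x)` for `x < 1`, and `1/(1 - x) ≤ 1 + 2x`... handle sign cases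
      rcases le_or_gt (-ν.re) 0 with hle | hgt
      · have := Real.exp_le_one_iff.2 hle
        linarith [norm_nonneg ν]
      · have h2 := Real.exp_bound_div_one_sub_of_interval' hgt (by linarith)
        have h3 : 1 / (1 - -ν.re) ≤ 1 + 2 * ‖ν‖ := by
          rw [div_le_iff₀ (by linarith)]
          nlinarith [norm_nonneg ν]
        linarith
    linarith
  · have := Real.add_one_le_exp (-ν.re)
    linarith

/-- **The bound on the fibre coordinate**: `ν_max = q_max / 4`. [folklore] -/
def nuMax : ℝ := qMax / 4

/-- `ν_max > 0`. [folklore] -/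
theorem nuMax_pos : 0 < nuMax := div_pos qMax_pos (by norm_num)

/-- `ν_max ≤ 1/2000`. [folklore] -/
theorem nuMax_le : nuMax ≤ 1 / 2000 := by
  have := qMax_le; unfold nuMax; linarith

/-- For `‖ν‖ ≤ ν_max`, `|q(ν)| ≤ q_max / 2 < q_max`. [folklore] -/
theorem abs_qOf_le_of_le {ν : ℂ} (hν : ‖ν‖ ≤ nuMax) : |qOf ν| ≤ qMax / 2 := by
  have h1 := nuMax_le
  have := abs_qOf_le (ν := ν) (by linarith)
  unfold nuMax at hν
  linarith

/-- For `‖ν‖ ≤ ν_max`, `|q(ν)| < q_max`. [folklore] -/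
theorem abs_qOf_lt {ν : ℂ} (hν : ‖ν‖ ≤ nuMax) : |qOf ν| < qMax := by
  have := abs_qOf_le_of_le hν; have := qMax_pos; linarith

/-! ### The fibre map of the graph zone -/

/-- **The ambient height** of the fibre point: `ξ(η, ν) = Ξ(η, q(ν))`. [folklore] -/
def xiV (η : ℝ) (ν : ℂ) : ℝ := XiF η (qOf ν)

/-- **The ambient polar distance** `X = 1 - ξ²`. [folklore] -/
def XV (η : ℝ) (ν : ℂ) : ℝ := 1 - xiV η ν ^ 2

/-- **The plane coordinate** `W = g(X) + ε(X)(e^ν - 1)` of the fibre point. [folklore] -/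
def WV (η : ℝ) (ν : ℂ) : ℂ :=
  ↑(IwasePolar.gprof (XV η ν)) + ↑(epsF (XV η ν)) * (Complex.exp ν - 1)

/-- **The fibre map** `(η, ν) ↦ (ξ, W)` of the graph zone (in meridian coordinates).
[folklore] -/
def fibV (p : ℝ × ℂ) : ℝ × ℂ := (xiV p.1 p.2, WV p.1 p.2)

/-- **Exactness witness**: `W - g(X) = ν · (ε(X) E(ν))`. [folklore] -/
theorem WV_sub_gprof (η : ℝ) (ν : ℂ) :
    WV η ν - ↑(IwasePolar.gprof (XV η ν)) = ν * (↑(epsF (XV η ν)) * Efun ν) := by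
  rw [WV, mul_left_comm, mul_Efun]; ring

/-- On the core (`ν = 0`): `ξ = η`, `W = g(1 - η²)`. [folklore] -/
theorem fibV_zero (η : ℝ) : fibV (η, 0) = (η, ↑(IwasePolar.gprof (1 - η ^ 2))) := by
  simp [fibV, xiV, XV, WV]

/-- The fibre coordinate recovered from `(ξ, W)`: `ν = log (1 + (W - g(X))/ε(X))`, `X = 1 - ξ²`.
[folklore] -/
def nuOf (ξ : ℝ) (W : ℂ) : ℂ :=
  Complex.log (1 + (W - ↑(IwasePolar.gprof (1 - ξ ^ 2))) / ↑(epsF (1 - ξ ^ 2)))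

/-- **The inverse fibre map** `(ξ, W) ↦ (η(ξ, q(ν)), ν)` with `ν = nuOf ξ W`. [folklore] -/
def fibVInv (w : ℝ × ℂ) : ℝ × ℂ := (etaOf w.1 (qOf (nuOf w.1 w.2)), nuOf w.1 w.2)

/-- `1 + (W - g(X))/ε(X) = e^ν` on the image. [folklore] -/
theorem one_add_div_eq (η : ℝ) (ν : ℂ) :
    1 + (WV η ν - ↑(IwasePolar.gprof (1 - xiV η ν ^ 2))) / ↑(epsF (1 - xiV η ν ^ 2)) =
      Complex.exp ν := by
  have hε : (↑(epsF (XV η ν)) : ℂ) ≠ 0 := Complex.ofReal_ne_zero.2 (epsF_pos _).ne'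
  rw [show 1 - xiV η ν ^ 2 = XV η ν from rfl, WV]
  field_simp
  ring

/-- `ν` is recovered: `nuOf ξ W = ν` for `|Im ν| < π`. [folklore] -/
theorem nuOf_fibV {η : ℝ} {ν : ℂ} (hν : |ν.im| < π) : nuOf (xiV η ν) (WV η ν) = ν := by
  obtain ⟨h1, h2⟩ := abs_lt.1 hν
  rw [nuOf, one_add_div_eq, Complex.log_exp h1 h2.le]

/-- **`fibVInv ∘ fibV = id`** for `‖ν‖ ≤ ν_max`. [folklore] -/
theorem fibVInv_fibV {η : ℝ} {ν : ℂ} (hν : ‖ν‖ ≤ nuMax) : fibVInv (fibV (η, ν)) = (η, ν) := by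
  have him : |ν.im| < π := by
    have := Complex.abs_im_le_norm ν; have := nuMax_le; have := pi_gt_three; linarith
  simp only [fibV, fibVInv]
  rw [nuOf_fibV him, xiV, etaOf_XiF (abs_qOf_lt hν).le]

/-- The fibre map is injective on `‖ν‖ ≤ ν_max`. [folklore] -/
theorem fibV_injOn : InjOn fibV {p : ℝ × ℂ | ‖p.2‖ ≤ nuMax} := by
  rintro ⟨η, ν⟩ hν ⟨η', ν'⟩ hν' h
  rw [← fibVInv_fibV (η := η) hν, ← fibVInv_fibV (η := η') hν', h]

/-- **`fibV ∘ fibVInv = id`** where the formulas invert: `1 + (W - g(X))/ε(X) ≠ 0` and the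
recovered `q` is admissible. [folklore] -/
theorem fibV_fibVInv {ξ : ℝ} {W : ℂ}
    (hz : 1 + (W - ↑(IwasePolar.gprof (1 - ξ ^ 2))) / ↑(epsF (1 - ξ ^ 2)) ≠ 0)
    (hq : |qOf (nuOf ξ W)| ≤ qMax) : fibV (fibVInv (ξ, W)) = (ξ, W) := by
  have hε : (↑(epsF (1 - ξ ^ 2)) : ℂ) ≠ 0 := Complex.ofReal_ne_zero.2 (epsF_pos _).ne'
  have hξ : xiV (etaOf ξ (qOf (nuOf ξ W))) (nuOf ξ W) = ξ := XiF_etaOf hq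
  have hX : XV (etaOf ξ (qOf (nuOf ξ W))) (nuOf ξ W) = 1 - ξ ^ 2 := by rw [XV, hξ]
  simp only [fibV, fibVInv, hξ, Prod.mk.injEq, true_and]
  rw [WV, hX, nuOf, Complex.exp_log hz]
  field_simp
  ring

/-! ### Smoothness of the fibre map and its inverse -/

/-- The fibre map is smooth where `|q(ν)| < 1/2`. [folklore] -/
theorem contDiffAt_fibV {p : ℝ × ℂ} (hp : |qOf p.2| < 1 / 2) : ContDiffAt ℝ ∞ fibV p := by
  have hq : ContDiff ℝ ∞ fun p : ℝ × ℂ => (p.1, qOf p.2) :=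
    contDiff_fst.prodMk (contDiff_qOf.comp contDiff_snd)
  have hxi' := (contDiffAt_XiF (p := (p.1, qOf p.2)) hp).comp p hq.contDiffAt
  have hxi : ContDiffAt ℝ ∞ (fun p : ℝ × ℂ => xiV p.1 p.2) p := hxi'
  have hX : ContDiffAt ℝ ∞ (fun p : ℝ × ℂ => XV p.1 p.2) p := contDiffAt_const.sub (hxi.pow 2)
  have hg := (IwasePolar.contDiff_gprof.contDiffAt).comp p hX
  have hε := (contDiff_epsF.contDiffAt).comp p hX
  have hW : ContDiffAt ℝ ∞ (fun p : ℝ × ℂ => WV p.1 p.2) p := by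
    unfold WV
    exact (Complex.ofRealCLM.contDiff.contDiffAt.comp p hg).add
      ((Complex.ofRealCLM.contDiff.contDiffAt.comp p hε).mul
        ((Complex.contDiff_exp.contDiffAt.comp p contDiffAt_snd).sub contDiffAt_const))
  exact hxi.prodMk hW

/-- The recovered fibre coordinate is smooth where `1 + (W - g(X))/ε(X)` is off the cut.
[folklore] -/
theorem contDiffAt_nuOf {w : ℝ × ℂ}
    (hz : 1 + (w.2 - ↑(IwasePolar.gprof (1 - w.1 ^ 2))) / ↑(epsF (1 - w.1 ^ 2)) ∈ Complex.slitPlane) :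
    ContDiffAt ℝ ∞ (fun w : ℝ × ℂ => nuOf w.1 w.2) w := by
  have hX : ContDiff ℝ ∞ fun w : ℝ × ℂ => 1 - w.1 ^ 2 := contDiff_const.sub (contDiff_fst.pow 2)
  have hg : ContDiff ℝ ∞ fun w : ℝ × ℂ => (↑(IwasePolar.gprof (1 - w.1 ^ 2)) : ℂ) :=
    Complex.ofRealCLM.contDiff.comp (IwasePolar.contDiff_gprof.comp hX)
  have hε : ContDiff ℝ ∞ fun w : ℝ × ℂ => (↑(epsF (1 - w.1 ^ 2)) : ℂ) :=
    Complex.ofRealCLM.contDiff.comp (contDiff_epsF.comp hX)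
  have hε0 : (↑(epsF (1 - w.1 ^ 2)) : ℂ) ≠ 0 := Complex.ofReal_ne_zero.2 (epsF_pos _).ne'
  have hz'' : ContDiffAt ℝ ∞ (fun w : ℝ × ℂ =>
      1 + (w.2 - ↑(IwasePolar.gprof (1 - w.1 ^ 2))) * (↑(epsF (1 - w.1 ^ 2)))⁻¹) w :=
    contDiffAt_const.add ((contDiffAt_snd.sub hg.contDiffAt).mul (hε.contDiffAt.inv hε0))
  have hfun : (fun w : ℝ × ℂ => 1 + (w.2 - ↑(IwasePolar.gprof (1 - w.1 ^ 2))) / ↑(epsF (1 - w.1 ^ 2))) =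
      fun w : ℝ × ℂ => 1 + (w.2 - ↑(IwasePolar.gprof (1 - w.1 ^ 2))) * (↑(epsF (1 - w.1 ^ 2)))⁻¹ := by
    funext w; rw [div_eq_mul_inv]
  have hz' : ContDiffAt ℝ ∞ (fun w : ℝ × ℂ =>
      1 + (w.2 - ↑(IwasePolar.gprof (1 - w.1 ^ 2))) / ↑(epsF (1 - w.1 ^ 2))) w := by
    rw [hfun]; exact hz''
  have hlog : ContDiffAt ℝ ∞ Complex.log
      (1 + (w.2 - ↑(IwasePolar.gprof (1 - w.1 ^ 2))) / ↑(epsF (1 - w.1 ^ 2))) :=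
    (Complex.contDiffAt_log hz).restrict_scalars ℝ
  have h := hlog.comp w hz'
  exact h

/-- **The inverse fibre map is smooth** where the formulas invert and `|q| < q_max`. [folklore] -/
theorem contDiffAt_fibVInv {w : ℝ × ℂ}
    (hz : 1 + (w.2 - ↑(IwasePolar.gprof (1 - w.1 ^ 2))) / ↑(epsF (1 - w.1 ^ 2)) ∈ Complex.slitPlane)
    (hq : |qOf (nuOf w.1 w.2)| < qMax) : ContDiffAt ℝ ∞ fibVInv w := by
  have hν := contDiffAt_nuOf hz
  have hqν : ContDiffAt ℝ ∞ (fun w : ℝ × ℂ => qOf (nuOf w.1 w.2)) w := contDiff_qOf.contDiffAt.comp w hν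
  have hpair : ContDiffAt ℝ ∞ (fun w : ℝ × ℂ => (w.1, qOf (nuOf w.1 w.2))) w :=
    contDiffAt_fst.prodMk hqν
  have hη' := (contDiffAt_etaOf (ξ := w.1) hq).comp w hpair
  have hη : ContDiffAt ℝ ∞ (fun w : ℝ × ℂ => etaOf w.1 (qOf (nuOf w.1 w.2))) w := hη'
  exact hη.prodMk hν

/-! ### The fibre map as an open partial homeomorphism; local diffeomorphism property -/

/-- `e^ν` is off the cut for `|Im ν| < π`. [folklore] -/
theorem exp_mem_slitPlane_of_abs_im_lt {ν : ℂ} (hν : |ν.im| < π) : Complex.exp ν ∈ Complex.slitPlane := by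
  obtain ⟨h1, h2⟩ := abs_lt.1 hν
  rw [Complex.exp_mem_slitPlane, toIocMod_eq_self Real.two_pi_pos |>.2 ⟨h1, by linarith⟩]
  exact h2.ne

/-- `|Im ν| < π` for `‖ν‖ ≤ ν_max`. [folklore] -/
theorem abs_im_lt_pi_of_le {ν : ℂ} (hν : ‖ν‖ ≤ nuMax) : |ν.im| < π := by
  have := Complex.abs_im_le_norm ν; have := nuMax_le; have := pi_gt_three; linarith

/-- For `‖ν‖ < ν_max`, `|q(ν)| < 1/2`. [folklore] -/
theorem abs_qOf_lt_half {ν : ℂ} (hν : ‖ν‖ < nuMax) : |qOf ν| < 1 / 2 := by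
  have h1 := abs_qOf_le_of_le hν.le; have h2 := qMax_le; linarith

/-- The source of the fibre chart: `‖ν‖ < ν_max`. [folklore] -/
def fibVSource : Set (ℝ × ℂ) := {p | ‖p.2‖ < nuMax}

/-- The target of the fibre chart: the formulas invert and the recovered `ν` is small.
[folklore] -/
def fibVTarget : Set (ℝ × ℂ) :=
  {w | 1 + (w.2 - ↑(IwasePolar.gprof (1 - w.1 ^ 2))) / ↑(epsF (1 - w.1 ^ 2)) ∈ Complex.slitPlane ∧
    ‖nuOf w.1 w.2‖ < nuMax}

/-- The source is open. [folklore] -/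
theorem isOpen_fibVSource : IsOpen fibVSource :=
  isOpen_lt (continuous_norm.comp continuous_snd) continuous_const

/-- The auxiliary map `w ↦ 1 + (W - g(X))/ε(X)` is continuous. [folklore] -/
theorem continuous_zAux : Continuous fun w : ℝ × ℂ =>
    1 + (w.2 - ↑(IwasePolar.gprof (1 - w.1 ^ 2))) / ↑(epsF (1 - w.1 ^ 2)) := by
  have hX : Continuous fun w : ℝ × ℂ => 1 - w.1 ^ 2 := by fun_prop
  refine continuous_const.add ((continuous_snd.sub (Complex.continuous_ofReal.comp
    (IwasePolar.contDiff_gprof.continuous.comp hX))).div (Complex.continuous_ofReal.comp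
      (contDiff_epsF.continuous.comp hX)) fun _ => ?_)
  exact Complex.ofReal_ne_zero.2 (epsF_pos _).ne'

/-- The target is open. [folklore] -/
theorem isOpen_fibVTarget : IsOpen fibVTarget := by
  rw [isOpen_iff_mem_nhds]
  rintro w ⟨hz, hν⟩
  have e1 : ∀ᶠ w' : ℝ × ℂ in 𝓝 w, 1 + (w'.2 - ↑(IwasePolar.gprof (1 - w'.1 ^ 2))) /
      ↑(epsF (1 - w'.1 ^ 2)) ∈ Complex.slitPlane :=
    continuous_zAux.continuousAt.preimage_mem_nhds (Complex.isOpen_slitPlane.mem_nhds hz)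
  have e2 : ∀ᶠ w' : ℝ × ℂ in 𝓝 w, ‖nuOf w'.1 w'.2‖ < nuMax :=
    (continuous_norm.continuousAt.comp (contDiffAt_nuOf hz).continuousAt).eventually_lt
      continuousAt_const hν
  filter_upwards [e1, e2] with w' h1 h2
  exact ⟨h1, h2⟩

/-- **The fibre map of the graph zone as an open partial homeomorphism.** [folklore] -/
def fibVPH : OpenPartialHomeomorph (ℝ × ℂ) (ℝ × ℂ) where
  toFun := fibV
  invFun := fibVInv
  source := fibVSource
  target := fibVTarget
  open_source := isOpen_fibVSource
  open_target := isOpen_fibVTarget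
  map_source' := by
    rintro ⟨η, ν⟩ hν
    change ‖ν‖ < nuMax at hν
    refine ⟨?_, ?_⟩
    · change 1 + (WV η ν - ↑(IwasePolar.gprof (1 - xiV η ν ^ 2))) / ↑(epsF (1 - xiV η ν ^ 2)) ∈ _
      rw [one_add_div_eq]
      exact exp_mem_slitPlane_of_abs_im_lt (abs_im_lt_pi_of_le hν.le)
    · change ‖nuOf (xiV η ν) (WV η ν)‖ < nuMax
      rwa [nuOf_fibV (abs_im_lt_pi_of_le hν.le)]
  map_target' := by
    rintro ⟨ξ, W⟩ ⟨_, hν⟩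
    exact hν
  left_inv' := by
    rintro ⟨η, ν⟩ hν
    exact fibVInv_fibV (le_of_lt hν)
  right_inv' := by
    rintro ⟨ξ, W⟩ ⟨hz, hν⟩
    exact fibV_fibVInv (Complex.slitPlane_ne_zero hz) (abs_qOf_lt hν.le).le
  continuousOn_toFun := fun p hp => (contDiffAt_fibV (abs_qOf_lt_half hp)).continuousAt.continuousWithinAt
  continuousOn_invFun := fun w hw => (contDiffAt_fibVInv hw.1 (abs_qOf_lt hw.2.le)).continuousAt.continuousWithinAt

/-- `fibVPH` is `fibV`. [folklore] -/
@[simp] theorem fibVPH_coe : (fibVPH : ℝ × ℂ → ℝ × ℂ) = fibV := rfl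

/-- `fibVPH.symm` is `fibVInv`. [folklore] -/
@[simp] theorem fibVPH_symm_coe : (fibVPH.symm : ℝ × ℂ → ℝ × ℂ) = fibVInv := rfl

/-- `fibV` is smooth on the source. [folklore] -/
theorem contDiffOn_fibV : ContDiffOn ℝ ∞ fibV fibVSource := fun _ hp =>
  (contDiffAt_fibV (abs_qOf_lt_half hp)).contDiffWithinAt

/-- `fibVInv` is smooth on the target. [folklore] -/
theorem contDiffOn_fibVInv : ContDiffOn ℝ ∞ fibVInv fibVTarget := fun _ hw =>
  (contDiffAt_fibVInv hw.1 (abs_qOf_lt hw.2.le)).contDiffWithinAt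

/-- **The fibre map of the graph zone is a local diffeomorphism** at every point with
`‖ν‖ < ν_max`. [folklore] -/
theorem isLocalDiffeomorphAt_fibV {p : ℝ × ℂ} (hp : ‖p.2‖ < nuMax) :
    IsLocalDiffeomorphAt 𝓘(ℝ, ℝ × ℂ) 𝓘(ℝ, ℝ × ℂ) ∞ fibV p :=
  isLocalDiffeomorphAt_of_contDiffOn_openPartialHomeomorph fibVPH hp contDiffOn_fibV
    contDiffOn_fibVInv (Filter.Eventually.of_forall fun _ => rfl)

/-! ### The fibre coordinate `ν(v) = ν_max · (squeeze v)` of the plane `ℝ²` -/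

/-- The norm of the squeezed vector: `‖univUnitBall v‖ < 1`. [folklore] -/
theorem norm_univUnitBall_lt (v : EuclideanSpace ℝ (Fin 2)) :
    ‖OpenPartialHomeomorph.univUnitBall v‖ < 1 :=
  mem_ball_zero_iff.1 (OpenPartialHomeomorph.univUnitBall.map_source (mem_univ v))

/-- **The fibre coordinate** `ν(v) = ν_max · toC (v/√(1 + ‖v‖²))` (`‖ν‖ < ν_max`, same direction
as `v`), built on Mathlib's `OpenPartialHomeomorph.univUnitBall`. [folklore] -/
def nuOfV (v : EuclideanSpace ℝ (Fin 2)) : ℂ := (nuMax : ℂ) * toC (OpenPartialHomeomorph.univUnitBall v)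

/-- The inverse: `v = univUnitBall⁻¹ (toE (ν / ν_max))`. [folklore] -/
def vOfNu (ν : ℂ) : EuclideanSpace ℝ (Fin 2) :=
  OpenPartialHomeomorph.univUnitBall.symm (IwasePolar.toE (ν / nuMax))

/-- `‖ν(v)‖ = ν_max ‖univUnitBall v‖`. [folklore] -/
theorem norm_nuOfV (v : EuclideanSpace ℝ (Fin 2)) :
    ‖nuOfV v‖ = nuMax * ‖OpenPartialHomeomorph.univUnitBall v‖ := by
  rw [nuOfV, norm_mul, Complex.norm_real, Real.norm_of_nonneg nuMax_pos.le, norm_toC]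

/-- `‖ν(v)‖ < ν_max`. [folklore] -/
theorem norm_nuOfV_lt (v : EuclideanSpace ℝ (Fin 2)) : ‖nuOfV v‖ < nuMax := by
  rw [norm_nuOfV]
  have := norm_univUnitBall_lt v
  have := nuMax_pos
  nlinarith

/-- `v(ν(v)) = v`. [folklore] -/
@[simp] theorem vOfNu_nuOfV (v : EuclideanSpace ℝ (Fin 2)) : vOfNu (nuOfV v) = v := by
  rw [vOfNu, nuOfV, mul_div_cancel_left₀ _ (Complex.ofReal_ne_zero.2 nuMax_pos.ne'),
    IwasePolar.toE_toC, OpenPartialHomeomorph.univUnitBall.left_inv (mem_univ v)]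

/-- `ν(v(ν)) = ν` for `‖ν‖ < ν_max`. [folklore] -/
theorem nuOfV_vOfNu {ν : ℂ} (hν : ‖ν‖ < nuMax) : nuOfV (vOfNu ν) = ν := by
  have h : IwasePolar.toE (ν / nuMax) ∈ Metric.ball (0 : EuclideanSpace ℝ (Fin 2)) 1 := by
    rw [mem_ball_zero_iff, IwasePolar.norm_toE, norm_div, Complex.norm_real,
      Real.norm_of_nonneg nuMax_pos.le, div_lt_one nuMax_pos]
    exact hν
  rw [nuOfV, vOfNu, OpenPartialHomeomorph.univUnitBall.right_inv h, IwasePolar.toC_toE,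
    mul_div_cancel₀ _ (Complex.ofReal_ne_zero.2 nuMax_pos.ne')]

/-- `ν` is injective. [folklore] -/
theorem nuOfV_injective : Injective nuOfV := HasLeftInverse.injective ⟨_, vOfNu_nuOfV⟩

/-- `ν(v) = 0 ↔ v = 0`. [folklore] -/
theorem nuOfV_eq_zero_iff {v : EuclideanSpace ℝ (Fin 2)} : nuOfV v = 0 ↔ v = 0 := by
  rw [← nuOfV_injective.eq_iff, show nuOfV 0 = 0 by
    rw [nuOfV, OpenPartialHomeomorph.univUnitBall_apply, smul_zero]; simp [toC, Complex.ext_iff]]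

/-- `ν(0) = 0`. [folklore] -/
@[simp] theorem nuOfV_zero : nuOfV 0 = 0 := nuOfV_eq_zero_iff.2 rfl

/-- `ν` is smooth. [folklore] -/
theorem contDiff_nuOfV : ContDiff ℝ ∞ nuOfV :=
  contDiff_const.mul (contDiff_toC.comp OpenPartialHomeomorph.contDiff_univUnitBall)

/-- `v(ν)` is smooth on `‖ν‖ < ν_max`. [folklore] -/
theorem contDiffAt_vOfNu {ν : ℂ} (hν : ‖ν‖ < nuMax) : ContDiffAt ℝ ∞ vOfNu ν := by
  have h : IwasePolar.toE (ν / nuMax) ∈ Metric.ball (0 : EuclideanSpace ℝ (Fin 2)) 1 := by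
    rw [mem_ball_zero_iff, IwasePolar.norm_toE, norm_div, Complex.norm_real,
      Real.norm_of_nonneg nuMax_pos.le, div_lt_one nuMax_pos]
    exact hν
  have e : vOfNu = OpenPartialHomeomorph.univUnitBall.symm ∘ fun ν : ℂ => IwasePolar.toE (ν / nuMax) := rfl
  rw [e]
  exact (OpenPartialHomeomorph.contDiffOn_univUnitBall_symm.contDiffAt (Metric.isOpen_ball.mem_nhds h)).comp ν
    (IwasePolar.contDiff_toE.contDiffAt.comp ν (contDiffAt_id.div_const (nuMax : ℂ)))

/-- **The fibre coordinate as an open partial homeomorphism** `ℝ² ≅ {‖ν‖ < ν_max}`. [folklore] -/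
def nuOfVPH : OpenPartialHomeomorph (EuclideanSpace ℝ (Fin 2)) ℂ where
  toFun := nuOfV
  invFun := vOfNu
  source := univ
  target := Metric.ball 0 nuMax
  open_source := isOpen_univ
  open_target := Metric.isOpen_ball
  map_source' := fun v _ => by rw [Metric.mem_ball, dist_zero_right]; exact norm_nuOfV_lt v
  map_target' := fun _ _ => mem_univ _
  left_inv' := fun v _ => vOfNu_nuOfV v
  right_inv' := fun ν hν => nuOfV_vOfNu (by rwa [Metric.mem_ball, dist_zero_right] at hν)
  continuousOn_toFun := contDiff_nuOfV.continuous.continuousOn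
  continuousOn_invFun := fun ν hν =>
    (contDiffAt_vOfNu (by rwa [Metric.mem_ball, dist_zero_right] at hν)).continuousAt.continuousWithinAt

/-- **The fibre coordinate is a local diffeomorphism everywhere.** [folklore] -/
theorem isLocalDiffeomorphAt_nuOfV (v : EuclideanSpace ℝ (Fin 2)) :
    IsLocalDiffeomorphAt 𝓘(ℝ, EuclideanSpace ℝ (Fin 2)) 𝓘(ℝ, ℂ) ∞ nuOfV v :=
  isLocalDiffeomorphAt_of_contDiffOn_openPartialHomeomorph nuOfVPH (mem_univ v)
    contDiff_nuOfV.contDiffOn (fun _ hν => (contDiffAt_vOfNu (mem_ball_zero_iff.1 hν)).contDiffWithinAt)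
    (Filter.Eventually.of_forall fun _ => rfl)

/-- The shear compatibility: `ν(v)` has the direction of `toC v`, i.e.
`nrm (ν(v)) = nrm (toC v)`. [folklore] -/
theorem nrm_nuOfV (v : EuclideanSpace ℝ (Fin 2)) :
    UnknotSurgery.nrm (nuOfV v) = UnknotSurgery.nrm (toC v) := by
  set t : ℝ := (Real.sqrt (1 + ‖v‖ ^ 2))⁻¹ with ht_def
  have ht : 0 < t := inv_pos.2 (Real.sqrt_pos.2 (by positivity))
  have hts : OpenPartialHomeomorph.univUnitBall v = t • v := OpenPartialHomeomorph.univUnitBall_apply v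
  have htoC : toC (OpenPartialHomeomorph.univUnitBall v) = (t : ℂ) * toC v := by
    rw [hts]
    apply Complex.ext <;> simp [toC]
  rw [nuOfV, htoC, ← mul_assoc, UnknotSurgery.nrm_mul, ← Complex.ofReal_mul,
    UnknotSurgery.nrm_ofReal_of_pos (mul_pos nuMax_pos ht), one_mul]

end IwaseTori
end Literature.Topology.FourManifolds
end
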